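import Summits.Ventures.PercRepro.MSRMStarUniv
import Summits.Ventures.PercRepro.MSRMStarTwinContract

/-!
# CONJECTURE V

Dossier proofs/MINE1-theoremS.md, Addendum 65. An instance of `ConjV` (ThetaTwoPairs.lean) — an
excess-one family `F` disjoint from its complement family with a near-member `u` for the sign
pattern `σ`, neither `F ∪ {u}` nor `F ∪ {uᶜ}` tight — that is twin-free is a residue instance
(`residue_of_twinFree`: the empty core, the full support and `∅, univ ∉ F` are the theorems of
ExcessOneCompletion.lean and ExcessOneResidueEmpty.lean), so `conjV_residue` (MSRMStarUniv.lean)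
gives its conclusion (`conjV_of_twinFree`). A general instance is contracted along its twin
classes (MSRMStarTwinContract.lean): the contracted instance is twin-free, its hypotheses are
those of the original transported by the contraction, and its conclusion pulls back because the
contraction is injective on families of twin-closed sets. Hence **`ConjV α` holds for every finite
ground type** (`conjV`).
-/

namespace PercRepro.MSTight

open Finset
open scoped FinsetFamily

variable {α : Type*} [DecidableEq α] [Fintype α]

section TwinFree

variable {F : Finset (Finset α)} {σ : Finset α → Bool} {u : Finset α}

/-- A twin-free instance of `ConjV` is a residue instance. -/
theorem residue_of_twinFree (hval : Disjoint F (compls F)) (hex : (F \\ F).card = F.card + 1)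
    (hu : u ∉ F) (huc : univ \ u ∉ F)
    (hcells : ∀ t ∈ F, Cells (F \\ F) t (if σ t = true then u else univ \ u))
    (hnt : ¬ Tight (insert u F)) (hntc : ¬ Tight (insert (univ \ u) F))
    (htf : ∀ a b, Twin F a b → a = b) : Residue F u where
  hexc := hex
  htf := htf
  hcore := fun a => exists_notMem_of_residue hex hu huc hcells hnt hntc a
  hsupp := fun a => exists_mem_of_residue hex hu huc hcells hnt hntc a
  hempty := empty_notMem_of_residue hval hex hu huc hcells hnt hntc
  huniv := univ_notMem_of_residue hval hex hu huc hcells hnt hntc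
  hvalid := fun t ht h => Finset.disjoint_left.1 hval ht (mem_compls.2 h)
  hu := hu
  hu' := huc
  hsig := fun t ht => by
    have := hcells t ht
    by_cases hσ : σ t = true
    · rw [if_pos hσ] at this; exact Or.inl this
    · rw [if_neg hσ] at this; exact Or.inr this
  hnt := hnt
  hnt' := hntc

/-- **Conjecture V for twin-free instances.** -/
theorem conjV_of_twinFree (hval : Disjoint F (compls F)) (hex : (F \\ F).card = F.card + 1)
    (hu : u ∉ F) (huc : univ \ u ∉ F)
    (hcells : ∀ t ∈ F, Cells (F \\ F) t (if σ t = true then u else univ \ u))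
    (hnt : ¬ Tight (insert u F)) (hntc : ¬ Tight (insert (univ \ u) F))
    (htf : ∀ a b, Twin F a b → a = b) :
    F \\ F = insert ∅ F ∨ F \\ F = insert ∅ (compls F) :=
  conjV_residue (residue_of_twinFree hval hex hu huc hcells hnt hntc htf)

end TwinFree

section Main

variable (α)

/-- **CONJECTURE V** (the candidate proposition `ConjV` of ThetaTwoPairs.lean): an MS-excess-one
family disjoint from its complement family, with a near-member `u` for a sign pattern `σ` and
with neither `F ∪ {u}` nor `F ∪ {uᶜ}` tight, is a block family or the mirror of one. -/
theorem conjV : ConjV α := by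
  intro F σ u hval hex hu huc hcells hnt hntc
  have hFne : F.Nonempty := by
    by_contra h
    rw [not_nonempty_iff_eq_empty] at h
    subst h
    simp at hex
  -- the near-member and its complement are twin-closed
  have hu_tc : TwinClosed F u := by
    obtain ⟨t, ht⟩ := hFne
    have := hcells t ht
    by_cases hσ : σ t = true
    · rw [if_pos hσ] at this
      exact twinClosed_of_cells ht this
    · rw [if_neg hσ] at this
      have h2 := (twinClosed_univ F).sdiff (twinClosed_of_cells ht this)
      rwa [compl_compl_eq] at h2
  have huc_tc : TwinClosed F (univ \ u) := (twinClosed_univ F).sdiff hu_tc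
  -- the contracted instance is twin-free: Conjecture V holds for it
  have key := conjV_of_twinFree (F := contractFam F F) (σ := fun s => σ (saturate F s))
    (u := contract F u) (disjoint_contractFam_compls hval)
    (by rw [card_diffs_contractFam famClosed_self, card_contractFam famClosed_self]; exact hex)
    (contract_notMem hu_tc hu)
    (by rw [← contract_compl hu_tc]; exact contract_notMem huc_tc huc)
    (by
      intro s hs
      obtain ⟨t, ht, rfl⟩ := mem_contractFam.1 hs
      simp only [saturate_contract (twinClosed_of_mem ht)]
      have := hcells t ht
      by_cases hσ : σ t = true
      · rw [if_pos hσ] at this ⊢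
        exact cells_contract (twinClosed_of_mem ht) hu_tc this
      · rw [if_neg hσ] at this ⊢
        rw [← contract_compl hu_tc]
        exact cells_contract (twinClosed_of_mem ht) huc_tc this)
    (by
      rw [← contractFam_insert, tight_contractFam_iff (famClosed_insert hu_tc famClosed_self)]
      exact hnt)
    (by
      rw [← contract_compl hu_tc, ← contractFam_insert,
        tight_contractFam_iff (famClosed_insert huc_tc famClosed_self)]
      exact hntc)
    (fun _ _ h => twin_contractFam_eq h)
  -- pull the conclusion back along the contraction
  rw [contractFam_diffs famClosed_self, ← contract_empty, ← contractFam_compls famClosed_self,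
    ← contractFam_insert, ← contractFam_insert] at key
  rcases key with h | h
  · exact Or.inl (contractFam_inj famClosed_diffs
      (famClosed_insert (twinClosed_empty F) famClosed_self) h)
  · exact Or.inr (contractFam_inj famClosed_diffs
      (famClosed_insert (twinClosed_empty F) (famClosed_compls famClosed_self)) h)

end Main

end PercRepro.MSTight
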